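import Summits.ResolutionOfSingularities.ResolutionOfSingularities.Theorems.PurelyInseparableDim4TorusEquivarianceCell
import Summits.ResolutionOfSingularities.ResolutionOfSingularities.Theorems.PurelyInseparableDim4LoopCLocalEscape
import Summits.ResolutionOfSingularities.ResolutionOfSingularities.Theorems.PurelyInseparableDim4IsolationAutomorphism
import HarnessLib

/-!
# [OURS · res-dim4-pi · F4-C-loc] THE LOCAL IN-SCOPE GAME IS TORUS-INVARIANT: `RWins q localB ⟨c·F(νx), r, exc⟩ ↔
  RWins q localB ⟨F, r, exc⟩` for a unit `c` and a unit torus element `ν` — IN-SCOPE included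

Cell `res-dim4-pi` (D-0157 DOOR 2, wave 2), seat `res-dim4-p-6` g4.  The lineage's `…TorusEquivariance` / `…TorusEquivarianceCell`
proved that the STEP and every step relation of record transport along the torus-and-unit orbit `F ↦ c·F(νx)` (written
inline as `C c * aeval (fun i => C (ν i) * X i) F`; `step_scale`, `step_C_mul`, `isEquimultiplePoint_scale_iff`,
`isPermissibleCentre_scale_iff`).  This file adds the two missing letters of the LOCAL in-scope game
(`LoopCLocal.RWins q localB`, A: in-scope permissible coordinate centres, B: equimultiple points over the current point):

* §1 **`inCoordinateScope_C_mul_scale_iff`** — IN COORDINATE SCOPE is invariant: the scaling is the `K`-algebra automorphism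
  `scaleEquiv ν` fixing the origin, so `J_q⁺(c·F(νx)) = scaleEquiv ν (J_q⁺(F))` (res-dim4-p-11's
  `CoordChange.singLocusIdeal_algEquiv`, plus `singLocusIdeal_C_mul`), minimal primes and `𝔪₀` move along
  (`CoordChange.map_originIdeal_algEquiv`), and coordinate ideals are torus-stable (`span_X_map_scaleEquiv`).
* §2 **`rWins_C_mul_scale`** / **`rWins_C_mul_scale_iff`** — by induction on `Game.Wins`: A repeats its centres; B's local
  reply `b` in chart `j` against the scaled state is the local reply `μ•b` against the state (`μ` the chart torus of `ν`),
  and the successor is again on the orbit (`step_C_mul` + `step_scale`).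

USE (the TORUS RULE of the seat's symbolic census, format v7): a one-letter family `G(t, x) = Σ c_e x^e t^{a_e}` with
`a_e + w·e = N` (`w ∈ ℤ⁴`) is `G(β, x) = β^N · G(1, β^{−w}x)` — ONE rational state up to the torus, so its local A-win over
every field follows from that of `G(1, x)`.  [OURS · counted 0 · elementary · AI kernel work, weaker than expert review.]
NOTHING here is a statement about resolution of singularities; resolution in dimension `≥ 4` / characteristic `p > 0` is
NOT proved by anything in this file.  bears_on: LADDER-RESOLUTION:D157-DOOR2 (res-dim4-pi · F4-C-loc · torus symmetry).
Host item (DR-157-C): `stmt-ResolutionOfSingularities-16155`, helper.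
-/

set_option linter.dupNamespace false -- mandated namespace of this single-conjunct summit

noncomputable section

open MvPolynomial Finset
open scoped BigOperators

namespace Summit.ResolutionOfSingularities.ResolutionOfSingularities.Theorems.PIDim4

namespace Torus

open Literature.AlgebraicGeometry.Resolution
open Literature.AlgebraicGeometry.Resolution.Hauser2010
open Literature.AlgebraicGeometry.Resolution.CentreBlowup
open LoopCLocal

variable {K : Type} [Field K]

/-! ## §1 IN COORDINATE SCOPE is torus-invariant -/

/-- the inverse scalings compose to the identity on the variables. OURS. [folklore] -/
theorem aeval_scale_inv_X {ν : Fin 4 → K} (hν : ∀ i, ν i ≠ 0) (i : Fin 4) :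
    aeval (fun i => C (ν i) * X i) (C (ν i)⁻¹ * X i : MvPolynomial (Fin 4) K) = X i := by
  rw [map_mul, aeval_C, aeval_X, algebraMap_eq, ← mul_assoc, ← map_mul, inv_mul_cancel₀ (hν i), C_1, one_mul]

/-- **the scaling by a unit torus element as a `K`-algebra automorphism** of `K[x₁..x₄]`. OURS. [folklore] -/
def scaleEquiv (ν : Fin 4 → K) (hν : ∀ i, ν i ≠ 0) : MvPolynomial (Fin 4) K ≃ₐ[K] MvPolynomial (Fin 4) K :=
  AlgEquiv.ofAlgHom (aeval fun i => C (ν i) * X i) (aeval fun i => C (ν i)⁻¹ * X i)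
    (MvPolynomial.algHom_ext fun i => by
      rw [AlgHom.comp_apply, AlgHom.id_apply, aeval_X, aeval_scale_inv_X hν])
    (MvPolynomial.algHom_ext fun i => by
      have h := aeval_scale_inv_X (ν := fun i => (ν i)⁻¹) (fun i => inv_ne_zero (hν i)) i
      simp only [inv_inv] at h
      rw [AlgHom.comp_apply, AlgHom.id_apply, aeval_X, h])

/-- `scaleEquiv` is the diagonal substitution. OURS. [folklore] -/
@[simp] theorem scaleEquiv_apply (ν : Fin 4 → K) (hν : ∀ i, ν i ≠ 0) (F : MvPolynomial (Fin 4) K) :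
    scaleEquiv ν hν F = aeval (fun i => C (ν i) * X i) F := rfl

/-- its inverse is the substitution by the inverse element. OURS. [folklore] -/
@[simp] theorem scaleEquiv_symm_apply (ν : Fin 4 → K) (hν : ∀ i, ν i ≠ 0) (F : MvPolynomial (Fin 4) K) :
    (scaleEquiv ν hν).symm F = aeval (fun i => C (ν i)⁻¹ * X i) F := rfl

/-- Hasse derivatives commute with constants. OURS. [folklore] -/
theorem hasseDeriv_C_mul (α : Fin 4 →₀ ℕ) (c : K) (F : MvPolynomial (Fin 4) K) :
    hasseDeriv α (C c * F) = C c * hasseDeriv α F := by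
  ext e
  rw [IsolatedBand.coeff_hasseDeriv, coeff_C_mul, coeff_C_mul, IsolatedBand.coeff_hasseDeriv]
  ring

/-- **`J_q⁺(c·F) = J_q⁺(F)`** for a non-zero constant `c`. OURS. [folklore] -/
theorem singLocusIdeal_C_mul (q : ℕ) {c : K} (hc : c ≠ 0) (F : MvPolynomial (Fin 4) K) :
    singLocusIdeal q (C c * F) = singLocusIdeal q F := by
  unfold singLocusIdeal
  refine le_antisymm (Ideal.span_le.mpr ?_) (Ideal.span_le.mpr ?_)
  · rintro G ⟨α, h0, hq, rfl⟩
    rw [hasseDeriv_C_mul]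
    exact Ideal.mul_mem_left _ _ (Ideal.subset_span ⟨α, h0, hq, rfl⟩)
  · rintro G ⟨α, h0, hq, rfl⟩
    have hmem : C c * hasseDeriv α F ∈ Ideal.span {G | ∃ α : Fin 4 →₀ ℕ, 0 < α.degree ∧ α.degree < q ∧
        G = hasseDeriv α (C c * F)} := Ideal.subset_span ⟨α, h0, hq, (hasseDeriv_C_mul α c F).symm⟩
    have := Ideal.mul_mem_left _ (C c⁻¹) hmem
    rwa [← mul_assoc, ← map_mul, inv_mul_cancel₀ hc, C_1, one_mul] at this

/-- **`J_q⁺(c·F(νx))` is the scaled `J_q⁺(F)`.** OURS. [folklore] -/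
theorem singLocusIdeal_C_mul_scale (q : ℕ) {c : K} (hc : c ≠ 0) {ν : Fin 4 → K} (hν : ∀ i, ν i ≠ 0)
    (F : MvPolynomial (Fin 4) K) :
    singLocusIdeal q (C c * aeval (fun i => C (ν i) * X i) F) =
      (singLocusIdeal q F).map (scaleEquiv ν hν : MvPolynomial (Fin 4) K →+* MvPolynomial (Fin 4) K) := by
  rw [singLocusIdeal_C_mul q hc, ← scaleEquiv_apply ν hν, CoordChange.singLocusIdeal_algEquiv]

/-- the scaling fixes the origin. OURS. [folklore] -/
theorem constantCoeff_scaleEquiv_X (ν : Fin 4 → K) (hν : ∀ i, ν i ≠ 0) (i : Fin 4) :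
    constantCoeff (scaleEquiv ν hν (X i)) = 0 := by
  rw [scaleEquiv_apply, aeval_X, map_mul, constantCoeff_X, mul_zero]

/-- **coordinate ideals are torus-stable.** OURS. [folklore] -/
theorem span_X_map_scaleEquiv (ν : Fin 4 → K) (hν : ∀ i, ν i ≠ 0) (S : Finset (Fin 4)) :
    (Ideal.span ((fun i => (X i : MvPolynomial (Fin 4) K)) '' (S : Set (Fin 4)))).map
        (scaleEquiv ν hν : MvPolynomial (Fin 4) K →+* MvPolynomial (Fin 4) K) =
      Ideal.span ((fun i => (X i : MvPolynomial (Fin 4) K)) '' (S : Set (Fin 4))) := by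
  rw [Ideal.map_span]
  refine le_antisymm (Ideal.span_le.mpr ?_) (Ideal.span_le.mpr ?_)
  · rintro G ⟨_, ⟨i, hi, rfl⟩, rfl⟩
    change scaleEquiv ν hν (X i) ∈ _
    rw [scaleEquiv_apply, aeval_X]
    exact Ideal.mul_mem_left _ _ (Ideal.subset_span ⟨i, hi, rfl⟩)
  · rintro _ ⟨i, hi, rfl⟩
    have hmem : scaleEquiv ν hν (X i) ∈ Ideal.span ((scaleEquiv ν hν : MvPolynomial (Fin 4) K →+* MvPolynomial (Fin 4) K) ''
        ((fun i => (X i : MvPolynomial (Fin 4) K)) '' (S : Set (Fin 4)))) :=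
      Ideal.subset_span ⟨X i, ⟨i, hi, rfl⟩, rfl⟩
    rw [scaleEquiv_apply, aeval_X] at hmem
    have := Ideal.mul_mem_left _ (C (ν i)⁻¹) hmem
    rwa [← mul_assoc, ← map_mul, inv_mul_cancel₀ (hν i), C_1, one_mul] at this

/-- `map` along the scaling is `comap` along the inverse scaling. OURS. [folklore] -/
theorem map_scaleEquiv_eq_comap (ν : Fin 4 → K) (hν : ∀ i, ν i ≠ 0) (I : Ideal (MvPolynomial (Fin 4) K)) :
    I.map (scaleEquiv ν hν : MvPolynomial (Fin 4) K →+* MvPolynomial (Fin 4) K) =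
      I.comap ((scaleEquiv ν hν).symm : MvPolynomial (Fin 4) K →+* MvPolynomial (Fin 4) K) :=
  Ideal.map_comap_of_equiv (scaleEquiv ν hν).toRingEquiv

/-- scaling back. OURS. [folklore] -/
theorem map_symm_map_scaleEquiv (ν : Fin 4 → K) (hν : ∀ i, ν i ≠ 0) (Q : Ideal (MvPolynomial (Fin 4) K)) :
    (Q.map (scaleEquiv ν hν : MvPolynomial (Fin 4) K →+* MvPolynomial (Fin 4) K)).map
        ((scaleEquiv ν hν).symm : MvPolynomial (Fin 4) K →+* MvPolynomial (Fin 4) K) = Q := by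
  rw [Ideal.map_map]
  have hid : ((scaleEquiv ν hν).symm : MvPolynomial (Fin 4) K →+* MvPolynomial (Fin 4) K).comp
      (scaleEquiv ν hν : MvPolynomial (Fin 4) K →+* MvPolynomial (Fin 4) K) = RingHom.id _ :=
    RingHom.ext fun F => (scaleEquiv ν hν).symm_apply_apply F
  rw [hid, Ideal.map_id]

/-- coordinate ideals go to coordinate ideals, and only they. OURS. [folklore] -/
theorem isCoordinateIdeal_map_scaleEquiv_iff (ν : Fin 4 → K) (hν : ∀ i, ν i ≠ 0)
    (P : Ideal (MvPolynomial (Fin 4) K)) :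
    IsCoordinateIdeal (P.map (scaleEquiv ν hν : MvPolynomial (Fin 4) K →+* MvPolynomial (Fin 4) K)) ↔
      IsCoordinateIdeal P := by
  constructor
  · rintro ⟨S, hS⟩
    refine ⟨S, ?_⟩
    -- apply the inverse scaling to `hS`; the inverse scaling is `scaleEquiv ν⁻¹` on coordinate ideals
    have hinv : ∀ i, (ν i)⁻¹ ≠ 0 := fun i => inv_ne_zero (hν i)
    have hsymm : ((scaleEquiv ν hν).symm : MvPolynomial (Fin 4) K →+* MvPolynomial (Fin 4) K) =
        (scaleEquiv (fun i => (ν i)⁻¹) hinv : MvPolynomial (Fin 4) K →+* MvPolynomial (Fin 4) K) :=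
      RingHom.ext fun F => rfl
    rw [← map_symm_map_scaleEquiv ν hν P, hS, hsymm, span_X_map_scaleEquiv]
  · rintro ⟨S, rfl⟩
    exact ⟨S, span_X_map_scaleEquiv ν hν S⟩

/-- minimal primes move with the scaling. OURS. [folklore] -/
theorem minimalPrimes_map_scaleEquiv (ν : Fin 4 → K) (hν : ∀ i, ν i ≠ 0) (I : Ideal (MvPolynomial (Fin 4) K)) :
    (I.map (scaleEquiv ν hν : MvPolynomial (Fin 4) K →+* MvPolynomial (Fin 4) K)).minimalPrimes =
      Ideal.map (scaleEquiv ν hν : MvPolynomial (Fin 4) K →+* MvPolynomial (Fin 4) K) '' I.minimalPrimes := by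
  rw [map_scaleEquiv_eq_comap]
  have h := Ideal.comap_minimalPrimes_eq_of_surjective
    (f := ((scaleEquiv ν hν).symm : MvPolynomial (Fin 4) K →+* MvPolynomial (Fin 4) K))
    (scaleEquiv ν hν).symm.surjective I
  exact h.trans (Set.image_congr fun P _ => (map_scaleEquiv_eq_comap ν hν P).symm)

/-- pulling an inclusion back through the scaling. OURS. [folklore] -/
theorem le_of_map_scaleEquiv_le (ν : Fin 4 → K) (hν : ∀ i, ν i ≠ 0) {I J : Ideal (MvPolynomial (Fin 4) K)}
    (h : I.map (scaleEquiv ν hν : MvPolynomial (Fin 4) K →+* MvPolynomial (Fin 4) K) ≤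
      J.map (scaleEquiv ν hν : MvPolynomial (Fin 4) K →+* MvPolynomial (Fin 4) K)) : I ≤ J := by
  have h' := Ideal.map_mono (f := ((scaleEquiv ν hν).symm : MvPolynomial (Fin 4) K →+* MvPolynomial (Fin 4) K)) h
  rwa [map_symm_map_scaleEquiv, map_symm_map_scaleEquiv] at h'

/-- **IN COORDINATE SCOPE is invariant along the torus-and-unit orbit.** OURS. [folklore] -/
theorem inCoordinateScope_C_mul_scale_iff (q : ℕ) {c : K} (hc : c ≠ 0) {ν : Fin 4 → K} (hν : ∀ i, ν i ≠ 0)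
    (F : MvPolynomial (Fin 4) K) :
    InCoordinateScope q (C c * aeval (fun i => C (ν i) * X i) F) ↔ InCoordinateScope q F := by
  unfold InCoordinateScope
  rw [singLocusIdeal_C_mul_scale q hc hν, minimalPrimes_map_scaleEquiv]
  have h0 := CoordChange.map_originIdeal_algEquiv (scaleEquiv ν hν) (constantCoeff_scaleEquiv_X ν hν)
  constructor
  · intro h P hP hP0
    have h1 := h _ ⟨P, hP, rfl⟩ (by rw [← h0]; exact Ideal.map_mono hP0)
    exact (isCoordinateIdeal_map_scaleEquiv_iff ν hν P).mp h1
  · rintro h _ ⟨P, hP, rfl⟩ hP0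
    refine (isCoordinateIdeal_map_scaleEquiv_iff ν hν P).mpr (h P hP ?_)
    rw [← h0] at hP0
    exact le_of_map_scaleEquiv_le ν hν hP0

/-! ## §2 A's local attractor is invariant -/

/-- condition (1) on the support from permissibility. OURS. [folklore] -/
theorem le_degIn_of_le_ordAlong {q : ℕ} {S : Finset (Fin 4)} {F : MvPolynomial (Fin 4) K}
    (h : (q : ℕ∞) ≤ ordAlong S F) : ∀ d ∈ F.support, q ≤ degIn S d := fun d hd => by
  have := le_trans h (Finset.inf_le hd)
  exact_mod_cast this

variable [DecidableEq K]

/-- **every local A-win transports along the orbit** `F ↦ c·F(νx)`. OURS. [folklore] -/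
theorem rWins_C_mul_scale {q : ℕ} {s : State K} (h : RWins q localB s) :
    ∀ (c : K) (ν : Fin 4 → K), c ≠ 0 → (∀ i, ν i ≠ 0) →
      RWins q localB (⟨C c * aeval (fun i => C (ν i) * X i) s.F, s.r, s.exc⟩ : State K) := by
  induction h with
  | terminal h0 =>
    intro c ν hc hν
    refine Game.Wins.terminal fun S hS => h0 S ?_
    exact ⟨(inCoordinateScope_C_mul_scale_iff q hc hν _).mp hS.1, (isPermissibleCentre_scale_iff hc hν q S _).mp hS.2⟩
  | @move x S hlegal _ ih =>
    intro c ν hc hν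
    refine Game.Wins.move (m := S) ⟨(inCoordinateScope_C_mul_scale_iff q hc hν _).mpr hlegal.1,
      (isPermissibleCentre_scale_iff hc hν q S _).mpr hlegal.2⟩ ?_
    rintro t' ⟨j, b, hj, hbj, hloc, heq, hne, rfl⟩
    have hq : ∀ d ∈ x.F.support, q ≤ degIn S d := le_degIn_of_le_ordAlong hlegal.2.2
    -- the chart torus `μ` of `ν`
    generalize hμ : (fun i => if i ∈ S ∧ i ≠ j then ν i / ν j else ν i) = μ
    have hμi : ∀ i, μ i = if i ∈ S ∧ i ≠ j then ν i / ν j else ν i := fun i => by rw [← hμ]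
    have hμne : ∀ i, μ i ≠ 0 := fun i => by
      rw [hμi]
      split_ifs
      · exact div_ne_zero (hν i) (hν j)
      · exact hν i
    have hμj : μ j = ν j := by rw [hμi j, if_neg (fun h => h.2 rfl)]
    have hlam : ∀ i, ν i = if i ∈ S ∧ i ≠ j then μ i * μ j else μ i := fun i => by
      by_cases h : i ∈ S ∧ i ≠ j
      · rw [if_pos h, hμi i, if_pos h, hμj, div_mul_cancel₀ _ (hν j)]
      · rw [if_neg h, hμi i, if_neg h]
    -- the reply `b` against the scaled state is the reply `μ•b` against the state
    set t := CentreBlowup.step q S j (fun i => μ i * b i) x with ht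
    have heq0 : IsEquimultiplePoint q S j (fun i => μ i * b i) x :=
      (isEquimultiplePoint_scale_iff hj hμne ν hlam b x hq).mp
        ((isEquimultiplePoint_C_mul_iff q S j hc b _ x.r x.exc).mp heq)
    have hstep : CentreBlowup.step q S j b (⟨C c * aeval (fun i => C (ν i) * X i) x.F, x.r, x.exc⟩ : State K) =
        ⟨C (c * μ j ^ q) * aeval (fun i => C (μ i) * X i) t.F, t.r, t.exc⟩ := by
      rw [step_C_mul q S j hc b _ x.r x.exc, step_scale hj hμne ν hlam b x hq, ← ht, map_mul, mul_assoc]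
    have hne0 : t.F ≠ 0 := by
      intro h0
      apply hne
      rw [hstep, h0, map_zero, mul_zero]
    have hbj0 : μ j * b j = 0 := by rw [hbj, mul_zero]
    have hloc0 : localB S j (fun i => μ i * b i) = true := by
      rw [localB_eq_true_iff] at hloc ⊢
      intro i hi
      rw [hloc i hi, mul_zero]
    rw [hstep]
    exact ih t ⟨j, fun i => μ i * b i, hj, hbj0, hloc0, heq0, hne0, ht⟩ _ _
      (mul_ne_zero hc (pow_ne_zero _ (hμne j))) hμne

omit [DecidableEq K] in
/-- scaling back the equation. OURS. [folklore] -/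
theorem C_mul_scale_inv {c : K} (hc : c ≠ 0) {ν : Fin 4 → K} (hν : ∀ i, ν i ≠ 0) (F : MvPolynomial (Fin 4) K) :
    C c⁻¹ * aeval (fun i => C (ν i)⁻¹ * X i) (C c * aeval (fun i => C (ν i) * X i) F) = F := by
  rw [map_mul, aeval_C, algebraMap_eq, ← mul_assoc, ← map_mul, inv_mul_cancel₀ hc, C_1, one_mul]
  exact (scaleEquiv ν hν).symm_apply_apply F

/-- **THE LOCAL IN-SCOPE GAME IS TORUS-INVARIANT**: `⟨c·F(νx), r, exc⟩` is a local A-win iff `⟨F, r, exc⟩` is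
(`c ∈ K*`, `ν ∈ (K*)⁴`). OURS. [folklore] -/
theorem rWins_C_mul_scale_iff {q : ℕ} {c : K} (hc : c ≠ 0) {ν : Fin 4 → K} (hν : ∀ i, ν i ≠ 0)
    (F : MvPolynomial (Fin 4) K) (r : Fin 4 →₀ ℕ) (exc : Finset (Fin 4)) :
    RWins q localB (⟨C c * aeval (fun i => C (ν i) * X i) F, r, exc⟩ : State K) ↔
      RWins q localB (⟨F, r, exc⟩ : State K) := by
  refine ⟨fun h => ?_, fun h => rWins_C_mul_scale h c ν hc hν⟩
  have h' := rWins_C_mul_scale h c⁻¹ (fun i => (ν i)⁻¹) (inv_ne_zero hc) (fun i => inv_ne_zero (hν i))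
  rwa [C_mul_scale_inv hc hν] at h'

end Torus

end Summit.ResolutionOfSingularities.ResolutionOfSingularities.Theorems.PIDim4

end
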